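import Summits.Ventures.LatticeQCDFlow.Scaling.HubModeTransport
import Summits.Ventures.LatticeQCDFlow.Scaling.FlowSamplerTunnelingTime

/-!
HONEST FRAMING: exact (Metropolis-corrected) sampling algorithms for lattice gauge theory; figures
of merit are autocorrelation/cost numbers at stated couplings and volumes; no continuum-physics
claim.

# HubModeTunnelingTime — THE HUB MODE-GAP FLOORS AS EQUILIBRIUM TUNNELLING TIMES: FROM EQUILIBRIUM, COLD REPLICA `k`
# OF THE BALANCED STAR OVER METASTABLE LEVELS ENTERS SECTOR `A` WITHIN
# `224K²(1 − μ_k(A))/(p(1−t)γ_A·min{tδ₂, γ₀(1−t)}·μ_k(A))` EXPECTED STEPS; WITH SECTOR-PRESERVING MAPS OF COVERING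
# RATIO `ρ` THE SAME WITH `δ₂ = ρ`, AND WITH PERFECT SECTOR-WISE CONDITIONAL TRANSPORTS WITH `δ₂ = 1`
# (lean-2 GEN-22, ours)

Venture-side (OURS).  Cell `lqcd-flow` (pub-lqcd), unit `pub-lqcd-lean-2-g22`, 2026-08-26.  Chapter J, file 6: the
floors of `Scaling/HubModeGap` (J3), `Scaling/FlowHubModeGap` (J4) and `Scaling/HubModeTransport` (J5) in the currency
practitioners quote for topological freezing — the expected number of sampler steps, started from equilibrium, before
a given cold replica visits a given sector — via `Scaling/FlowSamplerTunnelingTime.tunnelingTime_le_of_gapFloor`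
(itself `Scaling/EquilibriumExitCeiling`: a reversible chain with Poincaré constant `c` enters a set of mass `π(A)`
within `π(Aᶜ)/(c·π(A))` expected steps from equilibrium).  Setting and hypotheses exactly those of J3–J5 (balanced
weights `w_0 = ½`, `w_{k+1} = 1/(2K)`, one-sided persistence `p`, within-sector `γ_A`, hot `γ₀`, `δ₂` / covering
ratio `ρ`); the target is "replica `k` lies in `A`" for any level `k` and any set `A` of configurations with
`μ_k(A) > 0` (a sector, or any union of sectors).

## What is proved

* **`hubModeBalanced_tunnelingTime_le`** — identity maps: `Σ_x π̃(x)E_x(τ_{x_k∈A} ∧ N) ≤ (1 − μ_k(A))/(c·μ_k(A))`,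
  `c = p(1−t)γ_A·min{tδ₂, γ₀(1−t)}/(224K²)`, for every horizon `N`.
* **`flowHubModeCover_tunnelingTime_le`** — sector-preserving maps with transported covering ratio `ρ`: the same
  with `c = p(1−t)γ_A·min{tρ, γ₀(1−t)}/(224K²)`.
* **`flowHubModePerfect_tunnelingTime_le`** — perfect sector-wise conditional transports:
  `c = p(1−t)γ_A·min{t, γ₀(1−t)}/(224K²)`.

Reading (no numerics implied): the equilibrium tunnelling time of every cold replica of the balanced hub is at most
order `K²/(pγ_Aγ₀μ_k(A))` steps once the maps match the conditional shapes — polynomial in the number of replicas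
and free of the cold levels' own barrier-crossing times.  NOT CLAIMED: worst-case (non-equilibrium) starts; lower
bounds on tunnelling times (`Scaling/EquilibriumHittingFloor` / `…SectorHitting` give those from exit flows);
anything measured.  Literature grade (cell rule): ELEMENTARY COROLLARIES of the tree's floors; nothing cited as a
fact; no new bib keys.
-/

noncomputable section

open Finset Function
open Literature.Probability.MarkovChains
open Literature.Probability.MarkovChains.Decomposition

namespace Summit.Ventures.LatticeQCDFlow.Scaling

section HubTunneling

variable {S J : Type*} [Fintype S] [DecidableEq S] [Fintype J] [DecidableEq J] {K : ℕ}
  {μ : Fin (K + 1) → S → ℝ} (hμ : ∀ k x, 0 < μ k x) (hμ1 : ∀ k, ∑ x, μ k x = 1)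
  {M : Fin (K + 1) → S → S → ℝ} {mode : S → J} (hmode : Function.Surjective mode) {t : ℝ}

include hμ hμ1 hmode

/-- **THE BALANCED HUB (identity maps), EVERY COLD REPLICA, EVERY SECTOR:** from equilibrium, replica `k` enters `A`
(`μ_k(A) > 0`) within `(1 − μ_k(A))/(c·μ_k(A))` expected steps, `c = p(1−t)γ_A·min{tδ₂, γ₀(1−t)}/(224K²)` — for every
horizon `N` (`K ≥ 1`, `0 < t < 1`, `|S| ≥ 2`; hypotheses of `hubModeBalanced_spectralGap_ge`). [ours] -/
theorem hubModeBalanced_tunnelingTime_le [Nontrivial S] (hK : 1 ≤ K) (hM : ∀ k, IsRowStochastic (M k))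
    (hMrev : ∀ k, DetailedBalance (μ k) (M k)) (ht0 : 0 < t) (ht1 : t < 1)
    {p δ₂ γ₀ γA : ℝ} (hp : 0 < p) (hp1 : p ≤ 1) (hδ0 : 0 < δ₂) (hδ1 : δ₂ ≤ 1) (hγ₀ : 0 < γ₀) (hγA : 0 < γA)
    (hγA1 : γA ≤ 1)
    (hpers : ∀ (k : Fin K) (j : J), p * blockMass (μ k.succ) mode j ≤ blockMass (μ 0) mode j)
    (hδ : ∀ (i : Fin (K + 1) → J) (k : Fin K), i ∘ Equiv.swap (0 : Fin (K + 1)) k.succ ≠ i →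
      δ₂ * min (blockMass (tensorFun μ) (fun z : Fin (K + 1) → S => mode ∘ z) i)
          (blockMass (tensorFun μ) (fun z : Fin (K + 1) → S => mode ∘ z) (i ∘ Equiv.swap (0 : Fin (K + 1)) k.succ))
        ≤ ∑ x ∈ block (fun z : Fin (K + 1) → S => mode ∘ z) i,
            min (tensorFun μ x) (tensorFun μ (x ∘ Equiv.swap (0 : Fin (K + 1)) k.succ)))
    (hgap0 : ∀ h : S → ℝ, γ₀ * lawVariance (μ 0) h ≤ dirichletForm (μ 0) (M 0) h)
    (hgapA : ∀ k j, ∀ h : S → ℝ, γA * lawVariance (blockLaw (μ k) mode j) h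
      ≤ dirichletForm (blockLaw (μ k) mode j) (restrictionChain (M k) mode) h)
    (k : Fin (K + 1)) {A : Finset S} (hA : 0 < ∑ u ∈ A, μ k u) (N : ℕ) :
    ∑ x, tensorFun μ x * meanHitWithin (fun x y : Fin (K + 1) → S =>
          t * ptGraphSwap μ (fun k : Fin K => ((0 : Fin (K + 1)), k.succ)) (fun _ : Fin K => Equiv.refl S) x y
            + (1 - t) * prodKernel (fun k : Fin (K + 1) => if k = 0 then (1 : ℝ) / 2 else 1 / (2 * K)) M x y)
        (↑(univ.filter (fun x : Fin (K + 1) → S => x k ∈ A)) : Set (Fin (K + 1) → S)) N x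
      ≤ (1 - ∑ u ∈ A, μ k u)
          / (p * (1 - t) * γA * min (t * δ₂) (γ₀ * (1 - t)) / (224 * K ^ 2) * ∑ u ∈ A, μ k u) := by
  have hKr : (1 : ℝ) ≤ K := by exact_mod_cast hK
  have h1t : 0 < 1 - t := by linarith
  have hw0 : ∀ k : Fin (K + 1), 0 ≤ (if k = 0 then (1 : ℝ) / 2 else 1 / (2 * K)) := fun k => by
    split_ifs <;> positivity
  have hm : 0 < min (t * δ₂) (γ₀ * (1 - t)) := lt_min (by positivity) (by positivity)
  exact tunnelingTime_le_of_gapFloor hμ hμ1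
    (weightedScheme_isRowStochastic (ptGraphSwap_isRowStochastic hμ) hM hw0 (balancedWeight_sum hK) ht0.le ht1.le)
    (weightedScheme_detailedBalance (ptGraphSwap_detailedBalance hμ) hMrev t) (by positivity)
    (hubModeBalanced_spectralGap_ge_of_hotGap hμ hμ1 hmode hK hM hMrev ht0 ht1 hp hp1 hδ0 hδ1 hγ₀ hγA hγA1 hpers hδ
      hgap0 hgapA) k hA N

/-- **THE MAP-ASSISTED BALANCED HUB UNDER A TRANSPORTED COVERING RATIO `ρ`:** sector-preserving `φ_k`; from
equilibrium, replica `k` enters `A` within `(1 − μ_k(A))/(c·μ_k(A))` expected steps,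
`c = p(1−t)γ_A·min{tρ, γ₀(1−t)}/(224K²)`. [ours] -/
theorem flowHubModeCover_tunnelingTime_le [Nontrivial S] (φ : Fin K → Equiv.Perm S)
    (hφmode : ∀ (k : Fin K) (u : S), mode (φ k u) = mode u) (hK : 1 ≤ K) (hM : ∀ k, IsRowStochastic (M k))
    (hMrev : ∀ k, DetailedBalance (μ k) (M k)) (ht0 : 0 < t) (ht1 : t < 1)
    {p ρ γ₀ γA : ℝ} (hp : 0 < p) (hp1 : p ≤ 1) (hρ0 : 0 < ρ) (hρ1 : ρ ≤ 1) (hγ₀ : 0 < γ₀) (hγA : 0 < γA)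
    (hγA1 : γA ≤ 1)
    (hpers : ∀ (k : Fin K) (j : J), p * blockMass (μ k.succ) mode j ≤ blockMass (μ 0) mode j)
    (hcov : ∀ (k : Fin K) (u : S),
      ρ * (μ 0 u * blockMass (μ k.succ) mode (mode u)) ≤ μ k.succ (φ k u) * blockMass (μ 0) mode (mode u))
    (hgap0 : ∀ h : S → ℝ, γ₀ * lawVariance (μ 0) h ≤ dirichletForm (μ 0) (M 0) h)
    (hgapA : ∀ k j, ∀ h : S → ℝ, γA * lawVariance (blockLaw (μ k) mode j) h
      ≤ dirichletForm (blockLaw (μ k) mode j) (restrictionChain (M k) mode) h)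
    (k : Fin (K + 1)) {A : Finset S} (hA : 0 < ∑ u ∈ A, μ k u) (N : ℕ) :
    ∑ x, tensorFun μ x * meanHitWithin (fun x y : Fin (K + 1) → S =>
          t * ptGraphSwap μ (fun k : Fin K => ((0 : Fin (K + 1)), k.succ)) φ x y
            + (1 - t) * prodKernel (fun k : Fin (K + 1) => if k = 0 then (1 : ℝ) / 2 else 1 / (2 * K)) M x y)
        (↑(univ.filter (fun x : Fin (K + 1) → S => x k ∈ A)) : Set (Fin (K + 1) → S)) N x
      ≤ (1 - ∑ u ∈ A, μ k u)
          / (p * (1 - t) * γA * min (t * ρ) (γ₀ * (1 - t)) / (224 * K ^ 2) * ∑ u ∈ A, μ k u) := by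
  have hKr : (1 : ℝ) ≤ K := by exact_mod_cast hK
  have h1t : 0 < 1 - t := by linarith
  have hw0 : ∀ k : Fin (K + 1), 0 ≤ (if k = 0 then (1 : ℝ) / 2 else 1 / (2 * K)) := fun k => by
    split_ifs <;> positivity
  have hm : 0 < min (t * ρ) (γ₀ * (1 - t)) := lt_min (by positivity) (by positivity)
  exact tunnelingTime_le_of_gapFloor hμ hμ1
    (weightedScheme_isRowStochastic (ptGraphSwap_isRowStochastic hμ) hM hw0 (balancedWeight_sum hK) ht0.le ht1.le)
    (weightedScheme_detailedBalance (ptGraphSwap_detailedBalance hμ) hMrev t) (by positivity)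
    (flowHubModeCover_spectralGap_ge φ hφmode hμ hμ1 hmode hK hM hMrev ht0 ht1 hp hp1 hρ0 hρ1 hγ₀ hγA hγA1 hpers hcov
      hgap0 hgapA) k hA N

/-- **PERFECT SECTOR-WISE CONDITIONAL TRANSPORTS:** `μ_{k+1}(φ_k u)·μ_0(A_{mode u}) = μ_0(u)·μ_{k+1}(A_{mode u})` for all
`k`, `u` ⇒ from equilibrium replica `k` enters `A` within `(1 − μ_k(A))/(c·μ_k(A))` expected steps,
`c = p(1−t)γ_A·min{t, γ₀(1−t)}/(224K²)` — arbitrary cold conditional shapes, one-sidedly persistent weights. [ours] -/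
theorem flowHubModePerfect_tunnelingTime_le [Nontrivial S] (φ : Fin K → Equiv.Perm S)
    (hφmode : ∀ (k : Fin K) (u : S), mode (φ k u) = mode u) (hK : 1 ≤ K) (hM : ∀ k, IsRowStochastic (M k))
    (hMrev : ∀ k, DetailedBalance (μ k) (M k)) (ht0 : 0 < t) (ht1 : t < 1)
    {p γ₀ γA : ℝ} (hp : 0 < p) (hp1 : p ≤ 1) (hγ₀ : 0 < γ₀) (hγA : 0 < γA) (hγA1 : γA ≤ 1)
    (hpers : ∀ (k : Fin K) (j : J), p * blockMass (μ k.succ) mode j ≤ blockMass (μ 0) mode j)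
    (hperf : ∀ (k : Fin K) (u : S),
      μ k.succ (φ k u) * blockMass (μ 0) mode (mode u) = μ 0 u * blockMass (μ k.succ) mode (mode u))
    (hgap0 : ∀ h : S → ℝ, γ₀ * lawVariance (μ 0) h ≤ dirichletForm (μ 0) (M 0) h)
    (hgapA : ∀ k j, ∀ h : S → ℝ, γA * lawVariance (blockLaw (μ k) mode j) h
      ≤ dirichletForm (blockLaw (μ k) mode j) (restrictionChain (M k) mode) h)
    (k : Fin (K + 1)) {A : Finset S} (hA : 0 < ∑ u ∈ A, μ k u) (N : ℕ) :
    ∑ x, tensorFun μ x * meanHitWithin (fun x y : Fin (K + 1) → S =>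
          t * ptGraphSwap μ (fun k : Fin K => ((0 : Fin (K + 1)), k.succ)) φ x y
            + (1 - t) * prodKernel (fun k : Fin (K + 1) => if k = 0 then (1 : ℝ) / 2 else 1 / (2 * K)) M x y)
        (↑(univ.filter (fun x : Fin (K + 1) → S => x k ∈ A)) : Set (Fin (K + 1) → S)) N x
      ≤ (1 - ∑ u ∈ A, μ k u)
          / (p * (1 - t) * γA * min t (γ₀ * (1 - t)) / (224 * K ^ 2) * ∑ u ∈ A, μ k u) := by
  have hKr : (1 : ℝ) ≤ K := by exact_mod_cast hK
  have h1t : 0 < 1 - t := by linarith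
  have hw0 : ∀ k : Fin (K + 1), 0 ≤ (if k = 0 then (1 : ℝ) / 2 else 1 / (2 * K)) := fun k => by
    split_ifs <;> positivity
  have hm : 0 < min t (γ₀ * (1 - t)) := lt_min ht0 (by positivity)
  exact tunnelingTime_le_of_gapFloor hμ hμ1
    (weightedScheme_isRowStochastic (ptGraphSwap_isRowStochastic hμ) hM hw0 (balancedWeight_sum hK) ht0.le ht1.le)
    (weightedScheme_detailedBalance (ptGraphSwap_detailedBalance hμ) hMrev t) (by positivity)
    (flowHubModePerfect_spectralGap_ge φ hφmode hμ hμ1 hmode hK hM hMrev ht0 ht1 hp hp1 hγ₀ hγA hγA1 hpers hperf hgap0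
      hgapA) k hA N

end HubTunneling

end Summit.Ventures.LatticeQCDFlow.Scaling

end
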